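import Summits.CriticalPhenomena.PercolationContinuityZ3.Theorems.PercNearOneGluingNoHeavyQuantFarTwoAnchorLaw
import HarnessLib

/-!
# QUANT lane R8, front "FAR beyond trees", layer one — TWO-ANCHOR BLOCKS with RELAY ANCHORS: the internal law when the anchors themselves may be relays

builds on p205010 (kernel theorem, internal audit signed; external expert review pending)

Support file (`--supports stmt-CriticalPhenomena-4575`), seat `prim-quant-p1` (gen 19); memo
`run/shared/lean/prim/quant/prim-quant-p1-g19/FOR-LEAD-CACTI.md` §5 (assembly TODO: relay anchors).  Standard axioms; no sorries; no definitions.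

`…QuantFarTwoAnchorLaw` assumed the block relays are leaves (`A ∩ Z ⊆ L`).  In a cactus the anchors `v₁, v₂` (cycle vertices) are typically relays
themselves.  Here `A ∩ Z ⊆ L ∪ {v₁, v₂}`: the LOADED COUNT at `vᵢ` is `Yᵢ + bᵢ`, `Yᵢ = #{ℓ ∈ Aᵢ : s(vᵢ, ℓ) open}` over the leaves
`Aᵢ = {a ∈ A ∩ L : par a = vᵢ}` and `bᵢ = 𝟙[vᵢ ∈ A]`.
* `Block.card_on_eq_twoAnchor_loaded` — `#{a ∈ A ∩ Z : c ↔ a on Z} = 𝟙[E₁]·(Y₁ + b₁) + 𝟙[E₂]·(Y₂ + b₂)` on leaf-good configurations;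
* `Block.real_one_le_X_eq_loaded`, `Block.real_two_le_X_eq_loaded` — the same product formulas as in `…TwoAnchorLaw` with the loaded counts
  (the two-anchor algebra of `…TwoAnchorAlgebra` applies verbatim to the laws of `Yᵢ + bᵢ`).
[cite: Grimmett1999, §1.3 p. 10; §2.2]; bookkeeping [this work].
-/

noncomputable section

namespace Summit.CriticalPhenomena.PercolationContinuityZ3.Theorems

namespace Quant

namespace Block

open Finset MeasureTheory Set
open Literature.Probability.LatticeModels
open Literature.Probability.Percolation
open scoped Classical

variable {n : ℕ}

section TwoAnchor

variable {c v₁ v₂ : Fin n} {Z L : Finset (Fin n)} {par : Fin n → Fin n} (H : IsTwoAnchor c v₁ v₂ Z L par)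
include H

/-- **The block count with relay anchors.**  If `A ∩ Z ⊆ L ∪ {v₁, v₂}` then on a leaf-good configuration
`#{a ∈ A ∩ Z : c ↔ a on Z} = 𝟙[c ↔ v₁ in core]·(#{ℓ ∈ A₁ : s(v₁,ℓ) open} + 𝟙[v₁ ∈ A]) + 𝟙[c ↔ v₂ in core]·(#{ℓ ∈ A₂ : s(v₂,ℓ) open} + 𝟙[v₂ ∈ A])`,
`Aᵢ = {a ∈ (A ∩ L) ∩ Z : par a = vᵢ}`. [this work] -/
theorem card_on_eq_twoAnchor_loaded {ω : BondConfig (Fin n)} (hω : GoodL L par ω) {A : Finset (Fin n)} (hA : A ∩ Z ⊆ L ∪ {v₁, v₂}) :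
    ((A ∩ Z).filter fun a => onZ Z ω ∈ openConn c a).card =
      (if core Z L ω ∈ openConn c v₁ then
        ((((A ∩ L) ∩ Z).filter fun a => par a = v₁).filter fun ℓ => s(v₁, ℓ) ∈ ω).card + (if v₁ ∈ A then 1 else 0) else 0) +
      (if core Z L ω ∈ openConn c v₂ then
        ((((A ∩ L) ∩ Z).filter fun a => par a = v₂).filter fun ℓ => s(v₂, ℓ) ∈ ω).card + (if v₂ ∈ A then 1 else 0) else 0) := by
  -- split the block relays into leaves and anchors
  have hsplit : ((A ∩ Z).filter fun a => onZ Z ω ∈ openConn c a) =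
      (((A ∩ L) ∩ Z).filter fun a => onZ Z ω ∈ openConn c a) ∪ (((A ∩ Z) \ L).filter fun a => onZ Z ω ∈ openConn c a) := by
    ext a
    rw [Finset.mem_union, Finset.mem_filter, Finset.mem_filter, Finset.mem_filter, Finset.mem_inter, Finset.mem_inter, Finset.mem_inter,
      Finset.mem_sdiff, Finset.mem_inter]
    constructor
    · rintro ⟨⟨haA, haZ⟩, hr⟩
      by_cases haL : a ∈ L
      · exact Or.inl ⟨⟨⟨haA, haL⟩, haZ⟩, hr⟩
      · exact Or.inr ⟨⟨⟨haA, haZ⟩, haL⟩, hr⟩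
    · rintro (⟨⟨⟨haA, -⟩, haZ⟩, hr⟩ | ⟨⟨⟨haA, haZ⟩, -⟩, hr⟩) <;> exact ⟨⟨haA, haZ⟩, hr⟩
  have hdisj : Disjoint (((A ∩ L) ∩ Z).filter fun a => onZ Z ω ∈ openConn c a) (((A ∩ Z) \ L).filter fun a => onZ Z ω ∈ openConn c a) := by
    rw [Finset.disjoint_left]
    intro a h1 h2
    exact (Finset.mem_sdiff.1 (Finset.mem_filter.1 h2).1).2 (Finset.mem_inter.1 (Finset.mem_inter.1 (Finset.mem_filter.1 h1).1).1).2
  rw [hsplit, card_union_of_disjoint hdisj]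
  have hleaves := card_on_eq_twoAnchor H hω (A := A ∩ L) (fun a ha => (Finset.mem_inter.1 (Finset.mem_inter.1 ha).1).2)
  rw [hleaves]
  -- the anchors: `(A ∩ Z) ∖ L = {v₁, v₂} ∩ A`, and an anchor is reached on `Z` iff it is reached in the core
  have hset : ((A ∩ Z) \ L) = ({v₁, v₂} : Finset (Fin n)).filter fun a => a ∈ A := by
    ext a
    rw [Finset.mem_sdiff, Finset.mem_inter, Finset.mem_filter, Finset.mem_insert, Finset.mem_singleton]
    constructor
    · rintro ⟨⟨haA, haZ⟩, haL⟩
      have h := hA (Finset.mem_inter.2 ⟨haA, haZ⟩)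
      rw [Finset.mem_union, Finset.mem_insert, Finset.mem_singleton] at h
      rcases h with h | h
      · exact absurd h haL
      · exact ⟨h, haA⟩
    · rintro ⟨h, haA⟩
      rcases h with rfl | rfl
      · exact ⟨⟨haA, H.v₁Z⟩, H.v₁L⟩
      · exact ⟨⟨haA, H.v₂Z⟩, H.v₂L⟩
  have hanch : (((A ∩ Z) \ L).filter fun a => onZ Z ω ∈ openConn c a).card =
      (if v₁ ∈ A ∧ onZ Z ω ∈ openConn c v₁ then 1 else 0) + (if v₂ ∈ A ∧ onZ Z ω ∈ openConn c v₂ then 1 else 0) := by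
    rw [hset, Finset.filter_filter, Finset.card_filter, Finset.sum_pair H.hne]
  rw [hanch]
  have r1 : (onZ Z ω ∈ openConn c v₁) ↔ (core Z L ω ∈ openConn c v₁) := on_reach_iff_core H hω H.v₁L
  have r2 : (onZ Z ω ∈ openConn c v₂) ↔ (core Z L ω ∈ openConn c v₂) := on_reach_iff_core H hω H.v₂L
  rw [r1, r2]
  by_cases e1 : core Z L ω ∈ openConn c v₁ <;> by_cases e2 : core Z L ω ∈ openConn c v₂ <;>
    by_cases a1 : v₁ ∈ A <;> by_cases a2 : v₂ ∈ A <;>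
    simp only [e1, e2, a1, a2, if_true, if_false, and_true, and_false] <;> omega

/-- **`P(X ≥ 1)` of a two-anchor block** (block relays are leaves, a.s. leaf-good weights): with `Eᵢ = {c ↔ vᵢ in core}`,
`Aᵢ = {a ∈ A ∩ Z : par a = vᵢ}`, `Yᵢ = #{ℓ ∈ Aᵢ : s(vᵢ,ℓ) open}`:
`P(X ≥ 1) = P(E₁∖E₂)P(Y₁≥1) + P(E₂∖E₁)P(Y₂≥1) + P(E₁∩E₂)P(Y₁≥1) + P(E₁∩E₂)P(Y₁=0)P(Y₂≥1)`. [this work] -/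
theorem real_one_le_X_eq_loaded (v : Sym2 (Fin n) → unitInterval)
    (hv : ∀ ℓ ∈ L, ∀ x : Fin n, x ≠ ℓ → x ≠ par ℓ → (v s(ℓ, x) : ℝ) = 0) {A : Finset (Fin n)} (hA : A ∩ Z ⊆ L ∪ {v₁, v₂}) :
    (prodBernoulli v).real {ω | 1 ≤ ((A ∩ Z).filter fun a => onZ Z ω ∈ openConn c a).card} =
      (prodBernoulli v).real ({ω | core Z L ω ∈ openConn c v₁} \ {ω | core Z L ω ∈ openConn c v₂}) *
        (prodBernoulli v).real {ω | 1 ≤ (((((A ∩ L) ∩ Z).filter fun a => par a = v₁).filter fun ℓ => s(v₁, ℓ) ∈ ω).card + (if v₁ ∈ A then 1 else 0))} +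
      (prodBernoulli v).real ({ω | core Z L ω ∈ openConn c v₂} \ {ω | core Z L ω ∈ openConn c v₁}) *
        (prodBernoulli v).real {ω | 1 ≤ (((((A ∩ L) ∩ Z).filter fun a => par a = v₂).filter fun ℓ => s(v₂, ℓ) ∈ ω).card + (if v₂ ∈ A then 1 else 0))} +
      (prodBernoulli v).real ({ω | core Z L ω ∈ openConn c v₁} ∩ {ω | core Z L ω ∈ openConn c v₂}) *
        (prodBernoulli v).real {ω | 1 ≤ (((((A ∩ L) ∩ Z).filter fun a => par a = v₁).filter fun ℓ => s(v₁, ℓ) ∈ ω).card + (if v₁ ∈ A then 1 else 0))} +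
      (prodBernoulli v).real ({ω | core Z L ω ∈ openConn c v₁} ∩ {ω | core Z L ω ∈ openConn c v₂}) *
        (prodBernoulli v).real {ω | (((((A ∩ L) ∩ Z).filter fun a => par a = v₁).filter fun ℓ => s(v₁, ℓ) ∈ ω).card + (if v₁ ∈ A then 1 else 0)) = 0} *
        (prodBernoulli v).real {ω | 1 ≤ (((((A ∩ L) ∩ Z).filter fun a => par a = v₂).filter fun ℓ => s(v₂, ℓ) ∈ ω).card + (if v₂ ∈ A then 1 else 0))} := by
  set μ := prodBernoulli v with hμ
  have hmeas : ∀ U : Set (BondConfig (Fin n)), MeasurableSet U := fun U => (Set.toFinite U).measurableSet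
  set A₁ := ((A ∩ L) ∩ Z).filter fun a => par a = v₁ with hA₁
  set A₂ := ((A ∩ L) ∩ Z).filter fun a => par a = v₂ with hA₂
  have hA₁L : A₁ ⊆ L := fun a ha => (mem_inter.1 (mem_inter.1 (mem_filter.1 ha).1).1).2
  have hA₂L : A₂ ⊆ L := fun a ha => (mem_inter.1 (mem_inter.1 (mem_filter.1 ha).1).1).2
  set b₁ : ℕ := (if v₁ ∈ A then 1 else 0) with hb₁
  set b₂ : ℕ := (if v₂ ∈ A then 1 else 0) with hb₂
  set E₁ := {ω : BondConfig (Fin n) | core Z L ω ∈ openConn c v₁} with hE₁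
  set E₂ := {ω : BondConfig (Fin n) | core Z L ω ∈ openConn c v₂} with hE₂
  set S := {ω : BondConfig (Fin n) | 1 ≤ ((A ∩ Z).filter fun a => onZ Z ω ∈ openConn c a).card} with hS
  set G₁ := {ω : BondConfig (Fin n) | 1 ≤ ((A₁.filter fun ℓ => s(v₁, ℓ) ∈ ω).card + b₁)} with hG₁
  set G₂ := {ω : BondConfig (Fin n) | 1 ≤ ((A₂.filter fun ℓ => s(v₂, ℓ) ∈ ω).card + b₂)} with hG₂
  set Z₁ := {ω : BondConfig (Fin n) | ((A₁.filter fun ℓ => s(v₁, ℓ) ∈ ω).card + b₁) = 0} with hZ₁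
  -- the count on leaf-good configurations
  have hX : ∀ ω, GoodL L par ω → ((A ∩ Z).filter fun a => onZ Z ω ∈ openConn c a).card =
      (if ω ∈ E₁ then ((A₁.filter fun ℓ => s(v₁, ℓ) ∈ ω).card + b₁) else 0) +
      (if ω ∈ E₂ then ((A₂.filter fun ℓ => s(v₂, ℓ) ∈ ω).card + b₂) else 0) := fun ω hω => card_on_eq_twoAnchor_loaded H hω hA
  -- determinacy
  have hdE : ∀ (P : Prop → Prop → Prop), DeterminedBy {ω | P (ω ∈ E₁) (ω ∈ E₂)} (↑(corePairs Z L) : Set (Sym2 (Fin n))) :=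
    fun P => determinedBy_core Z L fun η => P (η ∈ openConn c v₁) (η ∈ openConn c v₂)
  have hdG₁ : DeterminedBy G₁ (↑(hairPairs v₁ A₁) : Set (Sym2 (Fin n))) := determinedBy_hair v₁ A₁ fun k => 1 ≤ k + b₁
  have hdG₂ : DeterminedBy G₂ (↑(hairPairs v₂ A₂) : Set (Sym2 (Fin n))) := determinedBy_hair v₂ A₂ fun k => 1 ≤ k + b₂
  have hdZ₁ : DeterminedBy Z₁ (↑(hairPairs v₁ A₁) : Set (Sym2 (Fin n))) := determinedBy_hair v₁ A₁ fun k => k + b₁ = 0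
  -- splits
  have s1 := measureReal_inter_add_sdiff (μ := μ) (s := S) (hmeas E₁)
  have s2 := measureReal_inter_add_sdiff (μ := μ) (s := S ∩ E₁) (hmeas E₂)
  have s3 := measureReal_inter_add_sdiff (μ := μ) (s := S \ E₁) (hmeas E₂)
  have s4 := measureReal_inter_add_sdiff (μ := μ) (s := S ∩ E₁ ∩ E₂) (hmeas G₁)
  -- identification of the pieces on leaf-good configurations
  have p1 : μ.real ((S ∩ E₁) \ E₂) = μ.real ({ω | ω ∈ E₁ ∧ ¬ ω ∈ E₂} ∩ G₁) := by
    refine real_congr_of_goodL v hv _ _ fun ω hω => ?_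
    simp only [Set.mem_sdiff, Set.mem_inter_iff, mem_setOf_eq, hS, hG₁]
    rw [hX ω hω]
    by_cases h1 : ω ∈ E₁ <;> by_cases h2 : ω ∈ E₂ <;>
      simp only [h1, h2, if_true, if_false, true_and, and_true, false_and, and_false, not_true_eq_false, not_false_eq_true, add_zero, zero_add]
  have p2 : μ.real ((S \ E₁) ∩ E₂) = μ.real ({ω | ω ∈ E₂ ∧ ¬ ω ∈ E₁} ∩ G₂) := by
    refine real_congr_of_goodL v hv _ _ fun ω hω => ?_
    simp only [Set.mem_sdiff, Set.mem_inter_iff, mem_setOf_eq, hS, hG₂]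
    rw [hX ω hω]
    by_cases h1 : ω ∈ E₁ <;> by_cases h2 : ω ∈ E₂ <;>
      simp only [h1, h2, if_true, if_false, true_and, and_true, false_and, and_false, not_true_eq_false, not_false_eq_true, add_zero, zero_add]
  have p3 : μ.real ((S \ E₁) \ E₂) = 0 := by
    have : μ.real ((S \ E₁) \ E₂) = μ.real (∅ : Set (BondConfig (Fin n))) := by
      refine real_congr_of_goodL v hv _ _ fun ω hω => ?_
      simp only [Set.mem_sdiff, mem_setOf_eq, hS, Set.mem_empty_iff_false, iff_false]
      rw [hX ω hω]
      by_cases h1 : ω ∈ E₁ <;> by_cases h2 : ω ∈ E₂ <;>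
        simp only [h1, h2, if_true, if_false, and_true, and_false, not_true_eq_false, not_false_eq_true, add_zero, zero_add, not_le]
      omega
    rw [this, measureReal_empty]
  have p4 : μ.real (S ∩ E₁ ∩ E₂ ∩ G₁) = μ.real ({ω | ω ∈ E₁ ∧ ω ∈ E₂} ∩ G₁) := by
    refine real_congr_of_goodL v hv _ _ fun ω hω => ?_
    simp only [Set.mem_inter_iff, mem_setOf_eq, hS, hG₁]
    rw [hX ω hω]
    by_cases h1 : ω ∈ E₁ <;> by_cases h2 : ω ∈ E₂ <;>
      simp only [h1, h2, if_true, if_false, true_and, and_true, false_and, and_false, add_zero, zero_add]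
    omega
  have p5 : μ.real ((S ∩ E₁ ∩ E₂) \ G₁) = μ.real ({ω | ω ∈ E₁ ∧ ω ∈ E₂} ∩ Z₁ ∩ G₂) := by
    refine real_congr_of_goodL v hv _ _ fun ω hω => ?_
    simp only [Set.mem_sdiff, Set.mem_inter_iff, mem_setOf_eq, hS, hG₁, hZ₁, hG₂]
    rw [hX ω hω]
    by_cases h1 : ω ∈ E₁ <;> by_cases h2 : ω ∈ E₂ <;>
      simp only [h1, h2, if_true, if_false, true_and, and_true, false_and, and_false, add_zero, zero_add, not_le]
    omega
  -- independence
  rw [real_core_hair v hA₁L v₁ (hdE fun a b => a ∧ ¬ b) hdG₁] at p1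
  rw [real_core_hair v hA₂L v₂ (hdE fun a b => b ∧ ¬ a) hdG₂] at p2
  rw [real_core_hair v hA₁L v₁ (hdE fun a b => a ∧ b) hdG₁] at p4
  rw [real_core_hair_hair H v hA₁L hA₂L (hdE fun a b => a ∧ b) hdZ₁ hdG₂] at p5
  -- the pattern events as differences / intersections
  have e10 : {ω : BondConfig (Fin n) | ω ∈ E₁ ∧ ¬ ω ∈ E₂} = E₁ \ E₂ := rfl
  have e01 : {ω : BondConfig (Fin n) | ω ∈ E₂ ∧ ¬ ω ∈ E₁} = E₂ \ E₁ := rfl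
  have e11 : {ω : BondConfig (Fin n) | ω ∈ E₁ ∧ ω ∈ E₂} = E₁ ∩ E₂ := rfl
  rw [e10] at p1; rw [e01] at p2; rw [e11] at p4 p5
  linarith [s1, s2, s3, s4, p1, p2, p3, p4, p5]

/-- **`P(X ≥ 2)` of a two-anchor block**:
`P(X ≥ 2) = P(E₁∖E₂)P(Y₁≥2) + P(E₂∖E₁)P(Y₂≥2) + P(E₁∩E₂)P(Y₁≥2) + P(E₁∩E₂)P(Y₁=1)P(Y₂≥1) + P(E₁∩E₂)P(Y₁=0)P(Y₂≥2)`. [this work] -/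
theorem real_two_le_X_eq_loaded (v : Sym2 (Fin n) → unitInterval)
    (hv : ∀ ℓ ∈ L, ∀ x : Fin n, x ≠ ℓ → x ≠ par ℓ → (v s(ℓ, x) : ℝ) = 0) {A : Finset (Fin n)} (hA : A ∩ Z ⊆ L ∪ {v₁, v₂}) :
    (prodBernoulli v).real {ω | 2 ≤ ((A ∩ Z).filter fun a => onZ Z ω ∈ openConn c a).card} =
      (prodBernoulli v).real ({ω | core Z L ω ∈ openConn c v₁} \ {ω | core Z L ω ∈ openConn c v₂}) *
        (prodBernoulli v).real {ω | 2 ≤ (((((A ∩ L) ∩ Z).filter fun a => par a = v₁).filter fun ℓ => s(v₁, ℓ) ∈ ω).card + (if v₁ ∈ A then 1 else 0))} +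
      (prodBernoulli v).real ({ω | core Z L ω ∈ openConn c v₂} \ {ω | core Z L ω ∈ openConn c v₁}) *
        (prodBernoulli v).real {ω | 2 ≤ (((((A ∩ L) ∩ Z).filter fun a => par a = v₂).filter fun ℓ => s(v₂, ℓ) ∈ ω).card + (if v₂ ∈ A then 1 else 0))} +
      (prodBernoulli v).real ({ω | core Z L ω ∈ openConn c v₁} ∩ {ω | core Z L ω ∈ openConn c v₂}) *
        (prodBernoulli v).real {ω | 2 ≤ (((((A ∩ L) ∩ Z).filter fun a => par a = v₁).filter fun ℓ => s(v₁, ℓ) ∈ ω).card + (if v₁ ∈ A then 1 else 0))} +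
      (prodBernoulli v).real ({ω | core Z L ω ∈ openConn c v₁} ∩ {ω | core Z L ω ∈ openConn c v₂}) *
        (prodBernoulli v).real {ω | (((((A ∩ L) ∩ Z).filter fun a => par a = v₁).filter fun ℓ => s(v₁, ℓ) ∈ ω).card + (if v₁ ∈ A then 1 else 0)) = 1} *
        (prodBernoulli v).real {ω | 1 ≤ (((((A ∩ L) ∩ Z).filter fun a => par a = v₂).filter fun ℓ => s(v₂, ℓ) ∈ ω).card + (if v₂ ∈ A then 1 else 0))} +
      (prodBernoulli v).real ({ω | core Z L ω ∈ openConn c v₁} ∩ {ω | core Z L ω ∈ openConn c v₂}) *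
        (prodBernoulli v).real {ω | (((((A ∩ L) ∩ Z).filter fun a => par a = v₁).filter fun ℓ => s(v₁, ℓ) ∈ ω).card + (if v₁ ∈ A then 1 else 0)) = 0} *
        (prodBernoulli v).real {ω | 2 ≤ (((((A ∩ L) ∩ Z).filter fun a => par a = v₂).filter fun ℓ => s(v₂, ℓ) ∈ ω).card + (if v₂ ∈ A then 1 else 0))} := by
  set μ := prodBernoulli v with hμ
  have hmeas : ∀ U : Set (BondConfig (Fin n)), MeasurableSet U := fun U => (Set.toFinite U).measurableSet
  set A₁ := ((A ∩ L) ∩ Z).filter fun a => par a = v₁ with hA₁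
  set A₂ := ((A ∩ L) ∩ Z).filter fun a => par a = v₂ with hA₂
  have hA₁L : A₁ ⊆ L := fun a ha => (mem_inter.1 (mem_inter.1 (mem_filter.1 ha).1).1).2
  have hA₂L : A₂ ⊆ L := fun a ha => (mem_inter.1 (mem_inter.1 (mem_filter.1 ha).1).1).2
  set b₁ : ℕ := (if v₁ ∈ A then 1 else 0) with hb₁
  set b₂ : ℕ := (if v₂ ∈ A then 1 else 0) with hb₂
  set E₁ := {ω : BondConfig (Fin n) | core Z L ω ∈ openConn c v₁} with hE₁
  set E₂ := {ω : BondConfig (Fin n) | core Z L ω ∈ openConn c v₂} with hE₂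
  set S := {ω : BondConfig (Fin n) | 2 ≤ ((A ∩ Z).filter fun a => onZ Z ω ∈ openConn c a).card} with hS
  set D₁ := {ω : BondConfig (Fin n) | 2 ≤ ((A₁.filter fun ℓ => s(v₁, ℓ) ∈ ω).card + b₁)} with hD₁
  set D₂ := {ω : BondConfig (Fin n) | 2 ≤ ((A₂.filter fun ℓ => s(v₂, ℓ) ∈ ω).card + b₂)} with hD₂
  set G₂ := {ω : BondConfig (Fin n) | 1 ≤ ((A₂.filter fun ℓ => s(v₂, ℓ) ∈ ω).card + b₂)} with hG₂
  set O₁ := {ω : BondConfig (Fin n) | ((A₁.filter fun ℓ => s(v₁, ℓ) ∈ ω).card + b₁) = 1} with hO₁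
  set Z₁ := {ω : BondConfig (Fin n) | ((A₁.filter fun ℓ => s(v₁, ℓ) ∈ ω).card + b₁) = 0} with hZ₁
  have hX : ∀ ω, GoodL L par ω → ((A ∩ Z).filter fun a => onZ Z ω ∈ openConn c a).card =
      (if ω ∈ E₁ then ((A₁.filter fun ℓ => s(v₁, ℓ) ∈ ω).card + b₁) else 0) +
      (if ω ∈ E₂ then ((A₂.filter fun ℓ => s(v₂, ℓ) ∈ ω).card + b₂) else 0) := fun ω hω => card_on_eq_twoAnchor_loaded H hω hA
  have hdE : ∀ (P : Prop → Prop → Prop), DeterminedBy {ω | P (ω ∈ E₁) (ω ∈ E₂)} (↑(corePairs Z L) : Set (Sym2 (Fin n))) :=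
    fun P => determinedBy_core Z L fun η => P (η ∈ openConn c v₁) (η ∈ openConn c v₂)
  have hdD₁ : DeterminedBy D₁ (↑(hairPairs v₁ A₁) : Set (Sym2 (Fin n))) := determinedBy_hair v₁ A₁ fun k => 2 ≤ k + b₁
  have hdD₂ : DeterminedBy D₂ (↑(hairPairs v₂ A₂) : Set (Sym2 (Fin n))) := determinedBy_hair v₂ A₂ fun k => 2 ≤ k + b₂
  have hdG₂ : DeterminedBy G₂ (↑(hairPairs v₂ A₂) : Set (Sym2 (Fin n))) := determinedBy_hair v₂ A₂ fun k => 1 ≤ k + b₂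
  have hdO₁ : DeterminedBy O₁ (↑(hairPairs v₁ A₁) : Set (Sym2 (Fin n))) := determinedBy_hair v₁ A₁ fun k => k + b₁ = 1
  have hdZ₁ : DeterminedBy Z₁ (↑(hairPairs v₁ A₁) : Set (Sym2 (Fin n))) := determinedBy_hair v₁ A₁ fun k => k + b₁ = 0
  -- splits
  have s1 := measureReal_inter_add_sdiff (μ := μ) (s := S) (hmeas E₁)
  have s2 := measureReal_inter_add_sdiff (μ := μ) (s := S ∩ E₁) (hmeas E₂)
  have s3 := measureReal_inter_add_sdiff (μ := μ) (s := S \ E₁) (hmeas E₂)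
  have s4 := measureReal_inter_add_sdiff (μ := μ) (s := S ∩ E₁ ∩ E₂) (hmeas D₁)
  have s5 := measureReal_inter_add_sdiff (μ := μ) (s := (S ∩ E₁ ∩ E₂) \ D₁) (hmeas O₁)
  -- pieces
  have p1 : μ.real ((S ∩ E₁) \ E₂) = μ.real ({ω | ω ∈ E₁ ∧ ¬ ω ∈ E₂} ∩ D₁) := by
    refine real_congr_of_goodL v hv _ _ fun ω hω => ?_
    simp only [Set.mem_sdiff, Set.mem_inter_iff, mem_setOf_eq, hS, hD₁]
    rw [hX ω hω]
    by_cases h1 : ω ∈ E₁ <;> by_cases h2 : ω ∈ E₂ <;>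
      simp only [h1, h2, if_true, if_false, true_and, and_true, false_and, and_false, not_true_eq_false, not_false_eq_true, add_zero, zero_add]
  have p2 : μ.real ((S \ E₁) ∩ E₂) = μ.real ({ω | ω ∈ E₂ ∧ ¬ ω ∈ E₁} ∩ D₂) := by
    refine real_congr_of_goodL v hv _ _ fun ω hω => ?_
    simp only [Set.mem_sdiff, Set.mem_inter_iff, mem_setOf_eq, hS, hD₂]
    rw [hX ω hω]
    by_cases h1 : ω ∈ E₁ <;> by_cases h2 : ω ∈ E₂ <;>
      simp only [h1, h2, if_true, if_false, true_and, and_true, false_and, and_false, not_true_eq_false, not_false_eq_true, add_zero, zero_add]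
  have p3 : μ.real ((S \ E₁) \ E₂) = 0 := by
    have : μ.real ((S \ E₁) \ E₂) = μ.real (∅ : Set (BondConfig (Fin n))) := by
      refine real_congr_of_goodL v hv _ _ fun ω hω => ?_
      simp only [Set.mem_sdiff, mem_setOf_eq, hS, Set.mem_empty_iff_false, iff_false]
      rw [hX ω hω]
      by_cases h1 : ω ∈ E₁ <;> by_cases h2 : ω ∈ E₂ <;>
        simp only [h1, h2, if_true, if_false, and_true, and_false, not_true_eq_false, not_false_eq_true, add_zero, zero_add, not_le]
      omega
    rw [this, measureReal_empty]
  have p4 : μ.real (S ∩ E₁ ∩ E₂ ∩ D₁) = μ.real ({ω | ω ∈ E₁ ∧ ω ∈ E₂} ∩ D₁) := by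
    refine real_congr_of_goodL v hv _ _ fun ω hω => ?_
    simp only [Set.mem_inter_iff, mem_setOf_eq, hS, hD₁]
    rw [hX ω hω]
    by_cases h1 : ω ∈ E₁ <;> by_cases h2 : ω ∈ E₂ <;>
      simp only [h1, h2, if_true, if_false, true_and, and_true, false_and, and_false, add_zero, zero_add]
    omega
  have p5 : μ.real (((S ∩ E₁ ∩ E₂) \ D₁) ∩ O₁) = μ.real ({ω | ω ∈ E₁ ∧ ω ∈ E₂} ∩ O₁ ∩ G₂) := by
    refine real_congr_of_goodL v hv _ _ fun ω hω => ?_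
    simp only [Set.mem_sdiff, Set.mem_inter_iff, mem_setOf_eq, hS, hD₁, hO₁, hG₂]
    rw [hX ω hω]
    by_cases h1 : ω ∈ E₁ <;> by_cases h2 : ω ∈ E₂ <;>
      simp only [h1, h2, if_true, if_false, true_and, and_true, false_and, and_false, add_zero, zero_add, not_le]
    omega
  have p6 : μ.real (((S ∩ E₁ ∩ E₂) \ D₁) \ O₁) = μ.real ({ω | ω ∈ E₁ ∧ ω ∈ E₂} ∩ Z₁ ∩ D₂) := by
    refine real_congr_of_goodL v hv _ _ fun ω hω => ?_
    simp only [Set.mem_sdiff, Set.mem_inter_iff, mem_setOf_eq, hS, hD₁, hO₁, hZ₁, hD₂]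
    rw [hX ω hω]
    by_cases h1 : ω ∈ E₁ <;> by_cases h2 : ω ∈ E₂ <;>
      simp only [h1, h2, if_true, if_false, true_and, and_true, false_and, and_false, add_zero, zero_add, not_le]
    omega
  rw [real_core_hair v hA₁L v₁ (hdE fun a b => a ∧ ¬ b) hdD₁] at p1
  rw [real_core_hair v hA₂L v₂ (hdE fun a b => b ∧ ¬ a) hdD₂] at p2
  rw [real_core_hair v hA₁L v₁ (hdE fun a b => a ∧ b) hdD₁] at p4
  rw [real_core_hair_hair H v hA₁L hA₂L (hdE fun a b => a ∧ b) hdO₁ hdG₂] at p5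
  rw [real_core_hair_hair H v hA₁L hA₂L (hdE fun a b => a ∧ b) hdZ₁ hdD₂] at p6
  have e10 : {ω : BondConfig (Fin n) | ω ∈ E₁ ∧ ¬ ω ∈ E₂} = E₁ \ E₂ := rfl
  have e01 : {ω : BondConfig (Fin n) | ω ∈ E₂ ∧ ¬ ω ∈ E₁} = E₂ \ E₁ := rfl
  have e11 : {ω : BondConfig (Fin n) | ω ∈ E₁ ∧ ω ∈ E₂} = E₁ ∩ E₂ := rfl
  rw [e10] at p1; rw [e01] at p2; rw [e11] at p4 p5 p6
  linarith [s1, s2, s3, s4, s5, p1, p2, p3, p4, p5, p6]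


end TwoAnchor

end Block

end Quant

end Summit.CriticalPhenomena.PercolationContinuityZ3.Theorems
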